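import Literature.AlgebraicGeometry.Morphisms.SectionsBaseChangeOfFibreVanishing
import Literature.AlgebraicGeometry.Modules.ModuleSectionsFlatBaseChange
import Literature.AlgebraicGeometry.KTheory.PullbackVectorBundle
import HarnessLib

/-!
# `H⁰` commutes with every base change through the local ring at a prime, given `H¹`-vanishing on that fibre

[cite: MumfordAV1970, §5, Corollary 3 (p. 53)]
[cite: Hartshorne1977, III Theorem 12.11 (p. 290)]
[cite: EGAIII2, 7.7.5 and 7.7.10]

Sequel to ★ `Morphisms/SectionsLiftOfFibreVanishingAtPrime` (surjectivity at a prime) and ★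
`Morphisms/SectionsBaseChangeOfFibreVanishing` (the isomorphism over a LOCAL base).  Setting (the consumer's frame):
`f : X → Spec A` proper and flat, `A` noetherian, `G` finite locally free on `X`, `𝔭` a prime of `A`, `X₀ = X ×_A κ(𝔭)` ANY
cartesian square over `Spec κ(𝔭) → Spec A` with `Ext¹_{𝒪_{X₀}}(𝒪_{X₀}, G|_{X₀}) = 0`.  MAIN THEOREM
(`exists_tensor_secMod_top_linearEquiv_through_prime`): for EVERY affine `B′` and every cartesian square
`X′ = X ×_A B′ → B′` whose base map FACTORS THROUGH `Spec A_𝔭 → Spec A` (`j = j′ ≫ Spec(A → A_𝔭)`; e.g. `B′ = Spec R′`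
for a local `A`-algebra `R′` whose maximal ideal lies over `𝔭`, or `B′ = Spec κ(𝔭)` itself, or any thickening of the
fibre), **`Γ(B′, 𝒪) ⊗_{Γ(Spec A, 𝒪)} Γ(X, G) ≃ Γ(X′, G|_{X′})`, `b ⊗ t ↦ b · η(t)`** — cohomology and base change in
degree `0` (Mumford §5 Cor. 3 / Hartshorne III 12.11 / EGA III 7.7.5 II) for all base changes through the local ring at
`𝔭`, which is the form in which «`p_*G` commutes with base change near `𝔭`» is consumed stalk-wise.

Proof: `X ×_A A_𝔭 → Spec A_𝔭` is proper flat over an affine base with LOCAL noetherian ring and closed fibre `X₀`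
(`IsPullback.of_right`); FLAT base change along `Spec A_𝔭 → Spec A` is an isomorphism on `H⁰` (★
`exists_tensor_secMod_top_linearEquiv_of_flat`); over the local base every affine base change is (★
`exists_tensor_secMod_top_linearEquiv_of_subsingleton_ext`, fed with the residue-field identification of §2 and the `Ext¹`
hypothesis transported along `(iX)^*G ≅ k₀^* k_l^*G`); the two are composed with Mathlib's
`TensorProduct.AlgebraTensorModule.cancelBaseChange` (`Γ(B′) ⊗_{Γ(A)} M ≅ Γ(B′) ⊗_{Γ(A_𝔭)} (Γ(A_𝔭) ⊗_{Γ(A)} M)`) and the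
transport `k^*G ≅ k′^* k_l^*G` (Mathlib `Scheme.Modules.pullbackComp`/`pullbackCongr`, ★ `pullbackComp_inv_app_unitSection`).
§1–§2 are the ring-level bookkeeping of ★ `SectionsLiftOfFibreVanishingAtPrime` (kept `private` there, repeated here).

Everything is proved; no named facts; theorems only.  Universe `Scheme.{0}`.  Cell `hodgecm-mathlib`, F-DAG (h2) geometric
glue (B-p19 (g14)); consumer: the (h6-d) base-change hypothesis (hbc) (B-p04 (g19) `Morphisms/ContainmentRepOfPushforward`,
`Modules/PushforwardBaseChangeHom`).  HC_CM is proved only modulo the 7 printed citations until rung 0 closes — nothing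
here bears on a summit statement.

## References

* D. Mumford, *Abelian Varieties*, TIFR Studies in Mathematics 5 (1970), §5, Cor. 3 (p. 53). [MumfordAV1970]
* R. Hartshorne, *Algebraic Geometry*, GTM 52 (1977), III Thm. 12.11 (p. 290). [Hartshorne1977]
* A. Grothendieck, EGA III₂ (Publ. Math. IHÉS 17, 1963), 7.7.5, 7.7.10. [EGAIII2]
-/

noncomputable section

set_option backward.isDefEq.respectTransparency false

open CategoryTheory CategoryTheory.Limits CategoryTheory.Abelian Opposite TopologicalSpace AlgebraicGeometry TensorProduct
open Literature.Algebra.Homology Literature.Algebra.Module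

namespace Literature.AlgebraicGeometry.Morphisms

open Literature.AlgebraicGeometry.Modules Literature.AlgebraicGeometry.HodgeTheory Literature.AlgebraicGeometry.Motives

/-! ## §1 The local base `Spec A_𝔭` and its closed point: ring-level bookkeeping -/

section LocalBase

variable {A : Type} [CommRing A] (𝔭 : Ideal A) [𝔭.IsPrime]

/-- `Γ(Spec R, 𝒪)` is a local ring when `R` is. [folklore] -/
private theorem isLocalRing_Γ_Spec (R : Type) [CommRing R] [IsLocalRing R] :
    IsLocalRing Γ(Spec (CommRingCat.of R), ⊤) :=
  haveI : Nontrivial Γ(Spec (CommRingCat.of R), ⊤) :=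
    (Scheme.ΓSpecIso (CommRingCat.of R)).symm.commRingCatIsoToRingEquiv.injective.nontrivial
  IsLocalRing.of_surjective' (Scheme.ΓSpecIso (CommRingCat.of R)).inv.hom
    (Scheme.ΓSpecIso (CommRingCat.of R)).symm.commRingCatIsoToRingEquiv.surjective

/-- `Spec.map φ` on global sections, in `appLE ⊤ ⊤` form, is `φ` conjugated by `ΓSpecIso`. [folklore] -/
private theorem appLE_SpecMap_apply {R S : Type} [CommRing R] [CommRing S] (φ : R →+* S) (r : Γ(Spec (CommRingCat.of R), ⊤)) :
    ((Spec.map (CommRingCat.ofHom φ)).appLE ⊤ ⊤ le_top).hom r =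
      (Scheme.ΓSpecIso (CommRingCat.of S)).inv (φ ((Scheme.ΓSpecIso (CommRingCat.of R)).hom r)) := by
  have h := Scheme.ΓSpecIso_inv_naturality (CommRingCat.ofHom φ)
  have h' := congrArg (fun ψ => ψ.hom ((Scheme.ΓSpecIso (CommRingCat.of R)).hom r)) h
  simp only [CommRingCat.hom_comp, RingHom.comp_apply, CommRingCat.hom_ofHom] at h'
  have e1 : (homOfLE (le_top : (⊤ : (Spec (CommRingCat.of S)).Opens) ≤
      (Spec.map (CommRingCat.ofHom φ)) ⁻¹ᵁ ⊤)) = 𝟙 ⊤ := Subsingleton.elim _ _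
  change ((Spec.map (CommRingCat.ofHom φ)).app ⊤ ≫
    (Spec (CommRingCat.of S)).presheaf.map (homOfLE le_top).op) r = _
  rw [e1, op_id]
  erw [CategoryTheory.Functor.map_id, Category.comp_id]
  rw [h', Iso.hom_inv_id_apply]

end LocalBase

/-! ## §2 The closed point of `Spec R`, `R` local: `Γ(Spec κ(R), 𝒪)` is the residue field of `Γ(Spec R, 𝒪)` -/

section Residue

variable (R : Type) [CommRing R] [IsLocalRing R]

/-- The ring map of `Spec κ(R) → Spec R` on global sections is onto. [folklore] -/
private theorem surjective_appLE_SpecMap_residue :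
    Function.Surjective ((Spec.map (CommRingCat.ofHom (IsLocalRing.residue R))).appLE ⊤ ⊤ le_top).hom := by
  intro y
  obtain ⟨x, hx⟩ := (Scheme.ΓSpecIso (CommRingCat.of (IsLocalRing.ResidueField R))).symm.commRingCatIsoToRingEquiv.surjective y
  obtain ⟨r, rfl⟩ := IsLocalRing.residue_surjective x
  obtain ⟨r', rfl⟩ := (Scheme.ΓSpecIso (CommRingCat.of R)).commRingCatIsoToRingEquiv.surjective r
  exact ⟨r', by rw [appLE_SpecMap_apply]; exact hx⟩

/-- **`Γ(Spec κ(R), 𝒪) ≅ κ(Γ(Spec R, 𝒪))` linearly over `Γ(Spec R, 𝒪)`** (through the ring map of `Spec κ(R) → Spec R`):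
the residue field of the local ring `Γ(Spec R, 𝒪) ≅ R` is identified with the global sections of `Spec κ(R)`. [folklore] -/
private theorem exists_residueField_linearEquiv_Γ_Spec :
    haveI := isLocalRing_Γ_Spec R
    letI := ((Spec.map (CommRingCat.ofHom (IsLocalRing.residue R))).appLE ⊤ ⊤ le_top).hom.toAlgebra
    Nonempty (IsLocalRing.ResidueField Γ(Spec (CommRingCat.of R), ⊤) ≃ₗ[Γ(Spec (CommRingCat.of R), ⊤)]
      Γ(Spec (CommRingCat.of (IsLocalRing.ResidueField R)), ⊤)) := by
  haveI := isLocalRing_Γ_Spec R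
  let φ := ((Spec.map (CommRingCat.ofHom (IsLocalRing.residue R))).appLE ⊤ ⊤ le_top).hom
  letI := φ.toAlgebra
  -- `φ` kills the maximal ideal of `Γ(Spec R, 𝒪)`
  have hφ : ∀ a ∈ IsLocalRing.maximalIdeal Γ(Spec (CommRingCat.of R), ⊤), φ a = 0 := by
    intro a ha
    change ((Spec.map (CommRingCat.ofHom (IsLocalRing.residue R))).appLE ⊤ ⊤ le_top).hom a = 0
    rw [appLE_SpecMap_apply]
    have ha' : (Scheme.ΓSpecIso (CommRingCat.of R)).hom a ∈ IsLocalRing.maximalIdeal R := by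
      rw [IsLocalRing.mem_maximalIdeal] at ha ⊢
      intro hu
      exact ha (by simpa using hu.map (Scheme.ΓSpecIso (CommRingCat.of R)).inv.hom)
    rw [(IsLocalRing.residue_eq_zero_iff _).2 ha', map_zero]
  let ψ : IsLocalRing.ResidueField Γ(Spec (CommRingCat.of R), ⊤) →+*
      Γ(Spec (CommRingCat.of (IsLocalRing.ResidueField R)), ⊤) :=
    Ideal.Quotient.lift _ φ hφ
  have hψ : ∀ r, ψ (IsLocalRing.residue _ r) = φ r := fun r => Ideal.Quotient.lift_mk _ _ _
  haveI : Nontrivial Γ(Spec (CommRingCat.of (IsLocalRing.ResidueField R)), ⊤) :=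
    (Scheme.ΓSpecIso (CommRingCat.of (IsLocalRing.ResidueField R))).symm.commRingCatIsoToRingEquiv.injective.nontrivial
  have hbij : Function.Bijective ψ :=
    ⟨ψ.injective, Ideal.Quotient.lift_surjective_of_surjective _ hφ (surjective_appLE_SpecMap_residue R)⟩
  exact ⟨{ (RingEquiv.ofBijective ψ hbij).toAddEquiv with
    map_smul' := fun c x => by
      obtain ⟨y, rfl⟩ := IsLocalRing.residue_surjective x
      change ψ (c • IsLocalRing.residue _ y) = φ c * ψ (IsLocalRing.residue _ y)
      rw [Algebra.smul_def, IsLocalRing.ResidueField.algebraMap_eq, map_mul, hψ] }⟩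

end Residue

/-! ## §3 Transport of global sections along an isomorphism of modules -/

section Transport

variable {Y : Scheme.{0}} {R : Type} [CommRing R] (ρ : R →+* Γ(Y, ⊤)) {M N : Y.Modules} (Φ : M ≅ N)

/-- An isomorphism of `𝒪_Y`-modules induces an `R`-linear equivalence of the modules of global sections (`R` acting
through `ρ : R → Γ(Y, 𝒪)`), `x ↦ Φ(x)`. [folklore] -/
private theorem exists_secMod_linearEquiv_of_iso :
    ∃ L : SecMod M ρ ⊤ ≃ₗ[R] SecMod N ρ ⊤,
      ∀ x, SecMod.val (L := N) (ρ := ρ) (L x) = Φ.hom.app ⊤ (SecMod.val (L := M) (ρ := ρ) x) := by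
  refine ⟨{ toFun := fun x => SecMod.mk (ρ := ρ) (Φ.hom.app ⊤ (SecMod.val (L := M) (ρ := ρ) x))
            invFun := fun y => SecMod.mk (ρ := ρ) (Φ.inv.app ⊤ (SecMod.val (L := N) (ρ := ρ) y))
            map_add' := fun x y => by
              apply SecMod.val_injective (L := N) (ρ := ρ)
              change Φ.hom.app ⊤ (SecMod.val (L := M) (ρ := ρ) x + SecMod.val (L := M) (ρ := ρ) y) = _
              rw [map_add]
              rfl
            map_smul' := fun c x => by
              apply SecMod.val_injective (L := N) (ρ := ρ)
              change Φ.hom.app ⊤ (toSections ρ ⊤ c • SecMod.val (L := M) (ρ := ρ) x) =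
                toSections ρ ⊤ c • Φ.hom.app ⊤ (SecMod.val (L := M) (ρ := ρ) x)
              rw [Scheme.Modules.Hom.app_smul]
            left_inv := fun x => by
              apply SecMod.val_injective (L := M) (ρ := ρ)
              change Φ.inv.app ⊤ (Φ.hom.app ⊤ (SecMod.val (L := M) (ρ := ρ) x)) = _
              rw [inv_app_hom_app]
            right_inv := fun y => by
              apply SecMod.val_injective (L := N) (ρ := ρ)
              change Φ.hom.app ⊤ (Φ.inv.app ⊤ (SecMod.val (L := N) (ρ := ρ) y)) = _
              rw [hom_app_inv_app] }, fun x => rfl⟩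

end Transport

/-! ## §4 Cohomology and base change in degree `0` through the local ring at a prime -/

section ThroughPrime

variable {A : Type} [CommRing A] [IsNoetherianRing A] {X : Scheme.{0}} (f : X ⟶ Spec (CommRingCat.of A))
  [IsProper f] [Flat f] (G : X.Modules) (hL : IsFiniteLocallyFree G) (𝔭 : Ideal A) [𝔭.IsPrime]
  {X₀ : Scheme.{0}} {iX : X₀ ⟶ X} {f₀ : X₀ ⟶ Spec (CommRingCat.of 𝔭.ResidueField)}
  (HX : IsPullback iX f₀ f (Spec.map (CommRingCat.ofHom (algebraMap A 𝔭.ResidueField))))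
  (hvan : Subsingleton (Ext.{1} (unitModule X₀) ((Scheme.Modules.pullback iX).obj G) 1))
  {X' B' : Scheme.{0}} [IsAffine B'] {g' : X' ⟶ B'} {k : X' ⟶ X} {j : B' ⟶ Spec (CommRingCat.of A)}
  (j' : B' ⟶ Spec (CommRingCat.of (Localization.AtPrime 𝔭)))
  (hj : j' ≫ Spec.map (CommRingCat.ofHom (algebraMap A (Localization.AtPrime 𝔭))) = j)
  (H : IsPullback k g' f j)

include hL HX hvan hj H in
/-- **`H⁰` COMMUTES WITH EVERY BASE CHANGE THROUGH `Spec A_𝔭`, given `H¹`-vanishing on the fibre at `𝔭`** (Mumford,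
*Abelian Varieties*, §5 Cor. 3; Hartshorne III Thm. 12.11; EGA III 7.7.5 II / 7.7.10 — in degree `0`, over an arbitrary
affine noetherian base, for all base changes factoring through the local ring at ONE prime): `f : X → Spec A` proper and
flat, `A` noetherian, `G` finite locally free on `X`, `X₀ = X ×_A κ(𝔭)` (any cartesian square) with
`Ext¹(𝒪_{X₀}, G|_{X₀}) = 0`; `B′` affine, `j = j′ ≫ Spec(A → A_𝔭) : B′ → Spec A`, `X′ = X ×_A B′` (any cartesian square
`H`).  Then `Γ(B′, 𝒪) ⊗_{Γ(Spec A, 𝒪)} Γ(X, G) ≃ Γ(X′, G|_{X′})` linearly over `Γ(B′, 𝒪)`, `b ⊗ t ↦ b · η(t)`.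
[cite: MumfordAV1970, §5 Cor. 3 (p. 53)] [cite: Hartshorne1977, III Thm. 12.11 (p. 290)] [cite: EGAIII2, 7.7.5] -/
theorem exists_tensor_secMod_top_linearEquiv_through_prime :
    letI := (j.appLE ⊤ ⊤ le_top).hom.toAlgebra
    ∃ E : Γ(B', ⊤) ⊗[Γ(Spec (CommRingCat.of A), ⊤)] SecMod G f.appTop.hom ⊤ ≃ₗ[Γ(B', ⊤)]
        SecMod ((Scheme.Modules.pullback k).obj G) g'.appTop.hom ⊤,
      ∀ (b : Γ(B', ⊤)) (t : SecMod G f.appTop.hom ⊤),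
        E (b ⊗ₜ t) = b • SecMod.mk (ρ := g'.appTop.hom) (unitSectionLE k G (V := ⊤) (U := ⊤) le_top
          (SecMod.val (L := G) (ρ := f.appTop.hom) t)) := by
  subst hj
  -- the local base `Spec A_𝔭` and its closed point `Spec κ(𝔭)`
  let Ap : Type := Localization.AtPrime 𝔭
  let jl : Spec (CommRingCat.of Ap) ⟶ Spec (CommRingCat.of A) := Spec.map (CommRingCat.ofHom (algebraMap A Ap))
  let j₀ : Spec (CommRingCat.of 𝔭.ResidueField) ⟶ Spec (CommRingCat.of Ap) :=
    Spec.map (CommRingCat.ofHom (IsLocalRing.residue Ap))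
  have hbot : j₀ ≫ jl = Spec.map (CommRingCat.ofHom (algebraMap A 𝔭.ResidueField)) := by
    change Spec.map _ ≫ Spec.map _ = _
    rw [← Spec.map_comp, ← CommRingCat.ofHom_comp]
    rfl
  -- the three ring maps `Γ(Spec A) → Γ(Spec A_𝔭) → Γ(B')` and the scalar tower they form
  letI i1 : Algebra Γ(Spec (CommRingCat.of A), ⊤) Γ(Spec (CommRingCat.of Ap), ⊤) := (jl.appLE ⊤ ⊤ le_top).hom.toAlgebra
  letI i2 : Algebra Γ(Spec (CommRingCat.of Ap), ⊤) Γ(B', ⊤) := (j'.appLE ⊤ ⊤ le_top).hom.toAlgebra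
  letI i3 : Algebra Γ(Spec (CommRingCat.of A), ⊤) Γ(B', ⊤) := ((j' ≫ jl).appLE ⊤ ⊤ le_top).hom.toAlgebra
  haveI : IsScalarTower Γ(Spec (CommRingCat.of A), ⊤) Γ(Spec (CommRingCat.of Ap), ⊤) Γ(B', ⊤) :=
    IsScalarTower.of_algebraMap_eq' (by
      change ((j' ≫ jl).appLE ⊤ ⊤ le_top).hom = (j'.appLE ⊤ ⊤ le_top).hom.comp (jl.appLE ⊤ ⊤ le_top).hom
      rw [← CommRingCat.hom_comp, Scheme.Hom.appLE_comp_appLE])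
  -- `X ×_A A_𝔭` and the square `X' → X ×_A A_𝔭` over `j'`
  let kl : pullback f jl ⟶ X := pullback.fst f jl
  let gl : pullback f jl ⟶ Spec (CommRingCat.of Ap) := pullback.snd f jl
  have Hl : IsPullback kl gl f jl := IsPullback.of_hasPullback f jl
  haveI : IsProper gl := MorphismProperty.pullback_snd (P := @IsProper) f jl inferInstance
  haveI : Flat gl := MorphismProperty.pullback_snd (P := @Flat) f jl inferInstance
  haveI : IsLocalRing Γ(Spec (CommRingCat.of Ap), ⊤) := isLocalRing_Γ_Spec Ap
  let k' : X' ⟶ pullback f jl := pullback.lift k (g' ≫ j') (by rw [Category.assoc]; exact H.w)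
  have hk' : k' ≫ kl = k := pullback.lift_fst _ _ _
  have hk'' : k' ≫ gl = g' ≫ j' := pullback.lift_snd _ _ _
  have H' : IsPullback k' g' gl j' := IsPullback.of_right (by rw [hk']; exact H) hk'' Hl
  -- the fibre square sits over the closed point of the local base
  have HX' : IsPullback iX f₀ f (j₀ ≫ jl) := by rw [hbot]; exact HX
  let k₀ : X₀ ⟶ pullback f jl := pullback.lift iX (f₀ ≫ j₀) (by rw [Category.assoc, hbot]; exact HX.w)
  have hk₀ : k₀ ≫ kl = iX := pullback.lift_fst _ _ _
  have hk₀' : k₀ ≫ gl = f₀ ≫ j₀ := pullback.lift_snd _ _ _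
  have H₀ : IsPullback k₀ f₀ gl j₀ := IsPullback.of_right (by rw [hk₀]; exact HX') hk₀' Hl
  -- the vector bundle on `X ×_A A_𝔭` and the residue-field identification
  have hLl : IsFiniteLocallyFree ((Scheme.Modules.pullback kl).obj G) := hL.pullback kl
  obtain ⟨e₀⟩ := exists_residueField_linearEquiv_Γ_Spec Ap
  -- notation
  let ρ : Γ(Spec (CommRingCat.of A), ⊤) →+* Γ(X, ⊤) := f.appTop.hom
  let ρl : Γ(Spec (CommRingCat.of Ap), ⊤) →+* Γ(pullback f jl, ⊤) := gl.appTop.hom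
  let ρ₀ : Γ(Spec (CommRingCat.of 𝔭.ResidueField), ⊤) →+* Γ(X₀, ⊤) := f₀.appTop.hom
  let ρ' : Γ(B', ⊤) →+* Γ(X', ⊤) := g'.appTop.hom
  let Gl : (pullback f jl).Modules := (Scheme.Modules.pullback kl).obj G
  let G₀ : X₀.Modules := (Scheme.Modules.pullback k₀).obj Gl
  let G' : X'.Modules := (Scheme.Modules.pullback k').obj Gl
  let ηX : SecMod G ρ ⊤ → SecMod ((Scheme.Modules.pullback iX).obj G) ρ₀ ⊤ := fun t =>
    SecMod.mk (ρ := ρ₀) (unitSectionLE iX G (V := ⊤) (U := ⊤) le_top (SecMod.val (L := G) (ρ := ρ) t))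
  let ηl : SecMod G ρ ⊤ → SecMod Gl ρl ⊤ := fun t =>
    SecMod.mk (ρ := ρl) (unitSectionLE kl G (V := ⊤) (U := ⊤) le_top (SecMod.val (L := G) (ρ := ρ) t))
  let η₀ : SecMod Gl ρl ⊤ → SecMod G₀ ρ₀ ⊤ := fun u =>
    SecMod.mk (ρ := ρ₀) (unitSectionLE k₀ Gl (V := ⊤) (U := ⊤) le_top (SecMod.val (L := Gl) (ρ := ρl) u))
  let η : SecMod G ρ ⊤ → SecMod ((Scheme.Modules.pullback k).obj G) ρ' ⊤ := fun t =>
    SecMod.mk (ρ := ρ') (unitSectionLE k G (V := ⊤) (U := ⊤) le_top (SecMod.val (L := G) (ρ := ρ) t))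
  let η' : SecMod Gl ρl ⊤ → SecMod G' ρ' ⊤ := fun u =>
    SecMod.mk (ρ := ρ') (unitSectionLE k' Gl (V := ⊤) (U := ⊤) le_top (SecMod.val (L := Gl) (ρ := ρl) u))
  -- pulled-back unit sections along a composite: `Φ_h : m^*G ≅ n^* kl^*G` for `n ≫ kl = m`, on global sections
  have hηunit : ∀ {Y Z : Scheme.{0}} (h : Y ⟶ Z) (M : Z.Modules) (m : Γ(M, ⊤)),
      unitSectionLE h M (V := ⊤) (U := ⊤) le_top m = unitSection h M ⊤ m := by
    intro Y Z h M m
    have e1 : (homOfLE (le_top : (⊤ : Y.Opens) ≤ h ⁻¹ᵁ ⊤)) = 𝟙 ⊤ := Subsingleton.elim _ _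
    unfold unitSectionLE
    rw [e1, op_id]
    erw [CategoryTheory.Functor.map_id]
    rfl
  have hcomp : ∀ (Y : Scheme.{0}) (m : Y ⟶ X) (n : Y ⟶ pullback f jl) (hn : n ≫ kl = m) (t : SecMod G ρ ⊤),
      Scheme.Modules.Hom.app
          ((Scheme.Modules.pullbackCongr hn.symm).app G ≪≫ ((Scheme.Modules.pullbackComp n kl).app G).symm).hom ⊤
          (unitSectionLE m G (V := ⊤) (U := ⊤) le_top (SecMod.val (L := G) (ρ := ρ) t)) =
        unitSectionLE n Gl (V := ⊤) (U := ⊤) le_top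
          (unitSectionLE kl G (V := ⊤) (U := ⊤) le_top (SecMod.val (L := G) (ρ := ρ) t)) := by
    intro Y m n hn t
    change ((Scheme.Modules.pullbackComp n kl).inv.app G).app ⊤
      (((Scheme.Modules.pullbackCongr hn.symm).hom.app G).app ⊤
        (unitSectionLE m G (V := ⊤) (U := ⊤) le_top (SecMod.val (L := G) (ρ := ρ) t))) = _
    rw [hηunit, hηunit, hηunit]
    have h1 := pullbackCongr_hom_app_unitSection G hn.symm ⊤ (SecMod.val (L := G) (ρ := ρ) t)
    simp only [eqToHom_refl, op_id] at h1
    change ((Scheme.Modules.pullbackComp n kl).inv.app G).app ((n ≫ kl) ⁻¹ᵁ ⊤)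
      (((Scheme.Modules.pullbackCongr hn.symm).hom.app G).app (m ⁻¹ᵁ ⊤)
        (unitSection m G ⊤ (SecMod.val (L := G) (ρ := ρ) t))) = _
    rw [h1]
    erw [CategoryTheory.Functor.map_id, CategoryTheory.id_apply]
    exact pullbackComp_inv_app_unitSection kl G n ⊤ (SecMod.val (L := G) (ρ := ρ) t)
  -- `Ext¹` vanishing transported along `Φ₀ : iX^* G ≅ k₀^* kl^* G`
  let Φ₀ : (Scheme.Modules.pullback iX).obj G ≅ G₀ :=
    (Scheme.Modules.pullbackCongr hk₀.symm).app G ≪≫ ((Scheme.Modules.pullbackComp k₀ kl).app G).symm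
  have hvan' : Subsingleton (Ext.{1} (unitModule X₀) G₀ 1) := by
    refine ⟨fun x y => ?_⟩
    have key : ∀ z : Ext.{1} (unitModule X₀) G₀ 1,
        z = (z.comp (Ext.mk₀ Φ₀.inv) (add_zero 1)).comp (Ext.mk₀ Φ₀.hom) (add_zero 1) := fun z => by
      rw [Ext.comp_assoc_of_second_deg_zero, Ext.mk₀_comp_mk₀, Iso.inv_hom_id, Ext.comp_mk₀_id]
    rw [key x, key y, Subsingleton.elim (x.comp _ _) (y.comp (Ext.mk₀ Φ₀.inv) (add_zero 1))]
  -- (1) over the local base: `Γ(B') ⊗_{Γ(A_𝔭)} Γ(X ×_A A_𝔭, G) ≃ Γ(X', k'^* kl^* G)`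
  obtain ⟨E₂, hE₂⟩ := exists_tensor_secMod_top_linearEquiv_of_subsingleton_ext gl Gl hLl H₀ e₀ hvan' H'
  -- (2) flat base change along `Spec A_𝔭 → Spec A`: `Γ(A_𝔭) ⊗_{Γ(A)} Γ(X, G) ≃ Γ(X ×_A A_𝔭, G)`
  obtain ⟨ι, _, _, U, hcov, hUa⟩ := exists_finite_affine_cover_cechOpen f
  haveI := hL.isVectorBundle.1
  have hG : IsAffineLocalizing G := IsAffineLocalizing.of_isQuasicoherent G
  haveI : Flat jl := by
    change Flat (Spec.map (CommRingCat.ofHom (algebraMap A Ap)))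
    rw [HasRingHomProperty.Spec_iff (P := @Flat)]
    change (algebraMap A Ap).Flat
    rw [RingHom.flat_algebraMap_iff]
    exact IsLocalization.flat Ap 𝔭.primeCompl
  have hflat : (jl.appLE ⊤ ⊤ le_top).hom.Flat :=
    HasRingHomProperty.appLE (P := @Flat) jl inferInstance ⟨⊤, isAffineOpen_top _⟩ ⟨⊤, isAffineOpen_top _⟩ le_top
  obtain ⟨E₁, hE₁⟩ := exists_tensor_secMod_top_linearEquiv_of_flat Hl U hcov hUa G hG hflat
  -- (3) transport along `Φ' : k^*G ≅ k'^* kl^*G`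
  obtain ⟨L, hL'⟩ := exists_secMod_linearEquiv_of_iso ρ'
    ((Scheme.Modules.pullbackCongr hk'.symm).app G ≪≫ ((Scheme.Modules.pullbackComp k' kl).app G).symm)
  have hLη : ∀ t, L (η t) = η' (ηl t) := fun t =>
    SecMod.val_injective (L := G') (ρ := ρ') ((hL' (η t)).trans (hcomp X' k k' hk' t))
  -- (4) compose: `Γ(B') ⊗_{Γ(A)} M ≃ Γ(B') ⊗_{Γ(A_𝔭)} (Γ(A_𝔭) ⊗_{Γ(A)} M) ≃ Γ(B') ⊗_{Γ(A_𝔭)} M_l ≃ Γ(X', G') ≃ Γ(X', k^*G)`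
  let C := (TensorProduct.AlgebraTensorModule.cancelBaseChange Γ(Spec (CommRingCat.of A), ⊤)
    Γ(Spec (CommRingCat.of Ap), ⊤) Γ(B', ⊤) Γ(B', ⊤) (SecMod G ρ ⊤)).symm
  let T := TensorProduct.AlgebraTensorModule.congr (LinearEquiv.refl Γ(B', ⊤) Γ(B', ⊤)) E₁
  refine ⟨C.trans (T.trans (E₂.trans L.symm)), fun b t => ?_⟩
  rw [LinearEquiv.trans_apply, LinearEquiv.trans_apply, LinearEquiv.trans_apply, LinearEquiv.symm_apply_eq]
  change E₂ (T (C (b ⊗ₜ t))) = L (b • η t)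
  rw [TensorProduct.AlgebraTensorModule.cancelBaseChange_symm_tmul, TensorProduct.AlgebraTensorModule.congr_tmul,
    LinearEquiv.refl_apply, hE₁, one_smul, hE₂, map_smul, hLη]

end ThroughPrime

end Literature.AlgebraicGeometry.Morphisms

end
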